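import Literature.MathematicalPhysics.QuantumLattice.HubbardFermiSeaTangentRowsDiluteBeyondHalfTPrimeM11o20
import Literature.MathematicalPhysics.QuantumLattice.HubbardFermiSeaTangentRowsDiluteFarPlanes
import Literature.MathematicalPhysics.QuantumLattice.HubbardFermiSeaTangentRowsDiluteFarTPrime
import Literature.MathematicalPhysics.QuantumLattice.HubbardFermiSeaTangentRowsQuarterFilling
import Literature.MathematicalPhysics.QuantumLattice.HubbardNNNHoppingEnergyDensityMonotone
import Summits.Ventures.CertifiedManyBodySolver.Certificates.HubbardSquare_n1_deepSheet_farColumnFloors_E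
import Summits.Ventures.CertifiedManyBodySolver.Certificates.HubbardSquare_n1_deepSheet_farColumnFloors_F
import Summits.Ventures.CertifiedManyBodySolver.Certificates.HubbardSquare_n1_deepSheet_farColumnFloors_G
import Summits.Ventures.CertifiedManyBodySolver.Certificates.HubbardSquare_n1_deepSheet_farColumnFloors_K5a
import Summits.Ventures.CertifiedManyBodySolver.Certificates.HubbardSquare_n1_deepSheet_farColumnFloors_K5b
import Summits.Ventures.CertifiedManyBodySolver.Certificates.HubbardSquare_n1_deepSheet_farColumnFloors_K5c
import Summits.Ventures.CertifiedManyBodySolver.Certificates.HubbardSquare_n1_deepSheet_farColumnFloors_K5d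
import Summits.Ventures.CertifiedManyBodySolver.Certificates.HubbardSquare_n1o2_farstrip_lower_jensen606_674_649
import Summits.Ventures.CertifiedManyBodySolver.Certificates.HubbardSquare_n7o8_TKT_obliqueStation_splitPlane_r554_r555_r590
import Summits.Ventures.CertifiedManyBodySolver.Certificates.HubbardSquare_n7o8_splitPlane2_stage2_byName_discharge
import Summits.Ventures.CertifiedManyBodySolver.Certificates.HubbardSquare_n7o8_splitPlaneQ1_byName_readers
import Summits.Ventures.CertifiedManyBodySolver.Certificates.HubbardTTPrime_polarizedBandCaps_kernelA
import Summits.Ventures.CertifiedManyBodySolver.Certificates.HubbardTTPrime_polarizedBandCaps_kernelB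
import Summits.Ventures.CertifiedManyBodySolver.Observables.PhaseSeparationExclusionBox
import Summits.Ventures.CertifiedManyBodySolver.Observables.PhaseSeparationExclusionFarOneYBCO
import Summits.Ventures.CertifiedManyBodySolver.Observables.PhaseSeparationExclusionFarPlanes
import Summits.Ventures.CertifiedManyBodySolver.Observables.PhaseSeparationExclusionFarQuarterNodes
import Summits.Ventures.CertifiedManyBodySolver.Observables.PhaseSeparationExclusionHalfFillingColumnU5
import Summits.Ventures.CertifiedManyBodySolver.Observables.PhaseSeparationExclusionHolePlaneCap
import Summits.Ventures.CertifiedManyBodySolver.Observables.PhaseSeparationExclusionQuarterConvexFloor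
import Summits.Ventures.CertifiedManyBodySolver.Observables.PhaseSeparationExclusionSevenEighthsAnchorsLowU
import Summits.Ventures.CertifiedManyBodySolver.Observables.PhaseSeparationExclusionSplitPlaneSevenEighthsCap
import Summits.Ventures.CertifiedManyBodySolver.Observables.PhaseSeparationExclusionStripPolCaps
import Summits.Ventures.CertifiedManyBodySolver.Observables.PhaseSeparationExclusionVirtualColumns
import HarnessLib
import HarnessLib.Audit

/-!
# PhaseSeparationExclusionFarPolCVK5GroundE1B (module doc replaced by redoc35)
K5 CORNER-LAW edition («THE K5 CORNER LAWS», hubbard-downfold-unc-2 g42, families K5…; generator `gen-g42/yb/gen42.py` over g41's): the `n = 1` column of the far cells at `U ∈ [49/10, 13/2]` may now be one of hubbard-box-eng-2 g23's RE-FLOORED deep-sheet laws `ds2_n1_law_U<U>_m<a>m<b>` (`Certificates/HubbardSquare_n1_deepSheet_farColumnFloors_K5{a,b,c,d}.lean`, C-174, ref-3 § F3-121 PASS 92/92): `t′`-chords of LP-exact simplex corners (`ds_n1_simplex3`: joint concavity of `(s,U) ↦ e(1,s,U,1)`, evenness + `t′`-monotonicity at `n = 1`, `U`-monotonicity) of the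 K-R1′ `(5,1,+1/2)` half-filling row (`hK5p50n1` BY VALUE, CANDIDATE class — hubbard-algo-eng-8 g8 kit j342506, CLAIM algoeng8-20260831-01, algo-ref g65 CELL-SIDE PASS), the M64 deep hole-side XL rows at `s = −16/25` (`hsX49o10m64n1` ∕ `hsX717o100m64n1`, fast-ref F99 ∕ F103 PASS), the B54 `(6,1,±3/10)` floor (`hB54`) and CERTIFIED #497 `(4,1,0)` BY NAME (`h497`): `(5,1,s) ≥ −0.8295 ∣ −0.8242 ∣ −0.8189` at `s = −2/5 ∣ −7/20 ∣ −3/10` (the flat `u5_n1_law_U5_m50p0` read −0.8402), `−0.8349` at `−9/20`; columns at `U = 49/10 ∣ 51/10 ∣ 133/25 ∣ 141/25 ∣ 6` and their `U`-chords `vk…` (`vcol_of_laws`) at `21/4 ∣ 11/2 ∣ 23/4`. The far quarter-filling points enter BY NAME: CERTIFIED #770 `(8,1/2,−2/5)` ∕ #783 `(6,1/2,−2/5)` claim nodes (`h770 : cert_r770_…` ∕ `h783 : cert_r783_…`, lit-4 p807955 ∕ p816497) through `hQ8m40_of_node` ∕ `hQ6m40_of_node` (`Observables/PhaseSeparationExclusionFarQuarterNodes.lean`,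 this seat). (5,1,+1/2) COLUMN edition (hubbard-downfold-unc-2 g41, families U5…): the `n = 1` column at `U ∈ [5, 6)` of the far cells with `|t′| ≤ 1/2` is the K-R1′ LEG B half-filling row (hubbard-algo-eng-8 g8 `twinchain-U5n1tp1o2-v082` kit j342506, see the law file's docstring for the exact literal and its class) read on the hole side by evenness + `t′`-monotonicity at `n = 1` (`u5_n1_law_U5_m50p0`, `Observables/PhaseSeparationExclusionHalfFillingColumnU5.lean`, hypothesis `hK5p50n1` BY VALUE) and its `U`-chords `vcol_of_laws` with the deep-sheet `U = 6` laws at `U ∈ {21/4, 11/2, 141/25, 23/4}` wherever they beat the deep-sheet `U = 5` column (−0.8716 ∣ −0.8632 ∣ −0.8548 at s = −1/2 ∣ −9/20 ∣ −2/5). WAVE-7c ITEM 2 edition («THE U = 6 QUARTER POINT», hubbard-downfold-unc-2 g41, generator `gen-g41/yb/gen41.py …` over the g40/g39/g38 generators; floor kinds `Q649`/`Q6F` next to g40's `Q606`/`Q674`/`QF`): the DILUTE floor at `n₁ = 1/2` may now use the FIRST quarter-filling e₀ LOWER at `U = 6`, `t′ < −3/10` — hubbard-algo-eng-8 g7's `GU6n1o2tpm2o5`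 (6, 1/2, −2/5) one-job n-twin chain RESULT (EXACT) kit j341763, `E_cert = −2729691028003404047260271/(5·2⁷⁹)` ⇒ floor `−0.9031789987` (hubbard-fast WAVE 7c ITEM 2; CLAIM algoeng8-20260830-11; algo-ref g65 CELL-SIDE PASS «CANDIDATE class, C48 legs pending», KEEP CORRECT; crit-1 S#484 CLEAN, crit-2 #332 CONCUR, captain RULINGS #973/#976 2026-08-30T23:5xZ; registry row #783 SIGNED (sr-mbsolver-ref-3 R3.498-57s) ⇒ NOW CERTIFIED #783 and read BY NAME: binder `h783 : cert_r783_bs_GU6n1o2tpm2o5_…` (lit-4 g40 p816497) through `hQ6m40_of_node` (`Observables/PhaseSeparationExclusionFarQuarterNodes.lean`)): on `[−2/5, −3/10]` its `t′`-chord with the CERTIFIED #649 `(6,1/2,−3/10)` lower (−0.9412223802) at `U = 6` carried up in `U` (`−0.9032 ∣ −0.9222 ∣ −0.9412` at `s = −2/5 ∣ −7/20 ∣ −3/10`, i.e. `+0.053 ∣ +0.026 ∣ 0` over the #649 Jensen floor and `+0.044 ∣ +0.015` over #606's for `U < 8`), and on `[−11/20, −2/5]` its `(t′,U)`-Jensen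 chord with the kernel free row at `t′ = −11/20` (`−0.9082` at `s = −41/100`, `−0.9283` at `−9/20`; valid for `U ≥ 40(s + 11/20)`, i.e. from `U = 6` at `s = −2/5` where the `U = 8` point needs `U ≥ 8`); extrapolated down the density by convexity for `(≤ 9/20 ∣ ≥ 1)` / `(≤ 2/5 ∣ ≥ 1)` exactly as the Q8/J floors. The STAGE-2 `7/8` plane is read BY NAME (`n7o8_splitPlane2_hW2m_of_node hW2o3` on `cert_plaqseam_W4splitO3_TBDP_allmk`, hubbard-fast-reuse-2 g21) wherever it caps. DEEP-SHEET COLUMN edition («THE FAR COLUMN REPAIR», hubbard-downfold-unc-2 g40, families DS/DSH200/DSH80): the `n = 1` COLUMNS of every far cell are hubbard-box-eng-2 g22's DEEP-SHEET far column laws `ds_n1_law_U<U>_m<a>m<b>` BY NAME (`Certificates/HubbardSquare_n1_deepSheet_farColumnFloors_{B..I}.lean`, 2026-08-30T21:27Z: LP-exact simplex floors from the deep hole-side M64 XL rows at `s = −16/25` (`hsX49o10m64n1` ∕ `hsX717o100m64n1` ∕ `hsX10m64n1`, fast-ref F99/F103 PASS), the electron-side B54/B67c/B85c rows, the S1/S9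 sheets and #497, by `t′`-monotonicity of `e(1,·,U,1)` on `s ≤ 0` (evenness + concavity) + `U`-monotonicity + joint concavity; `+0.05…0.21·t` over every earlier far column incl. this seat's (8,12)-chords and corner chords) wherever they are the best law on the cell's segment (the theorem docstrings name the law per column); their by-value binders appear in each signature exactly as the law files print them. WAVE-7c QUARTER-POINT edition (this file; hubbard-downfold-unc-2 g40, generator `gen-g40/yb/gen40.py … ` with the `Q606`/`Q674`/`QF` floor kinds): the DILUTE floor at `n₁ = 1/2` may now use the FIRST quarter-filling e₀ LOWER at `t′ < −3/10` — hubbard-algo-eng-8 g7's `GU8n1o2tpm2o5` (8, 1/2, −2/5) twin-chain RESULT (EXACT) kit j341204, `E_cert = −676700214379598560086999/(5·2⁷⁷) = −0.8956052766` (hubbard-fast WAVE 7c ITEM 1; crit-2 VERDICT #315, surr-4 SCORE, crit-1 S#467 CLEAN, captain RULINGS #919 «PRINTED, KEEP-class CANDIDATE», 2026-08-30T20:19–20:25Z; registry row #783 SIGNED (sr-mbsolver-ref-3 R3.498-57s) ⇒ hypothesis `hQ8m40 : −0.8956052766… ≤ e(1, −2/5, 8, 1/2)` BY VALUE, CANDIDATE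 class, discharged BY NAME by a one-line wrapper the hour the node lands): on `[−2/5, −3/10]` its `t′`-chord with the CERTIFIED #606 `(8,1/2,−3/10)` (−0.9270952558) ∣ #674 `(10,1/2,−3/10)` (−0.9178886431) lowers at `U = 8 ∣ 10` carried up in `U` (`−0.8956 ∣ −0.9113 ∣ −0.9271` at `s = −2/5 ∣ −7/20 ∣ −3/10`, i.e. `+0.052 ∣ +0.026` over the #606 Jensen floor and `+0.047 ∣ +0.019` over #674's), and on `[−11/20, −2/5]` its `(t′,U)`-Jensen chord with the kernel free row at `t′ = −11/20` (`−0.9011` at `s = −41/100`, `+0.044`; valid for `U ≥ 160(s + 11/20)/3`); extrapolated down the density by convexity for `(≤ 9/20 ∣ ≥ 1)` / `(≤ 2/5 ∣ ≥ 1)` exactly as the J-floors. FAR VIRTUAL-COLUMN edition («THE (8,12) CHORD», hubbard-downfold-unc-2 g40, generator `gen-g40/yb/gen40.py …`): on the far strips the `n = 1` COLUMNS at `U⋆ ∈ {42/5, 17/2, 9, 10, 11}` are now VIRTUAL columns (`vcol_of_laws`, `Observables/PhaseSeparationExclusionVirtualColumns.lean`, g37 device: concavity of `U ↦ e(1,s,U,1)`,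 the `U`-chord of two LANDED column laws read at `U⋆`) of the `U = 8` law `ext5_n1_col8_m40` ∕ `fp_n1_col8_m65m40` and the `U = 12` law `fp_n1_col12_m50m30` ∕ `fp_n1_col12_m65m50` BY NAME (their producer anchors `hsX8m40n1`, `h428`, `hN12m50`, `hsX12m30n1`, … exactly as printed in those laws): on `[−2/5,−3/10]` the chord reads `−0.5465 ∣ −0.4814` at `(10, s = −2/5 ∣ −3/10)` and `−0.5615 ∣ −0.5471` at `U⋆ = 17/2`, i.e. `0.065–0.093·t` ABOVE the N1-tier point floors `hN10m40`/`hN10m35` (`far_n1_col10_m40m35` −0.6110 ∣ −0.5917, `far_n1_law10`) and the box-eng sheet column `fy1_col17o2_m40m30` (−0.6475 ∣ −0.6402) that every earlier far edition used at `U = 17/2, 9, 10, 11` — the loosest ingredient of the far words was the `n = 1` column, not the cap: `(≤ 1/2 ∣ ≥ 1)` `T = 0` margins on A2 `[8,10] ∣ [10,12]` 0.033 ∣ 0.036 → 0.077 ∣ 0.074, A1 0.034 → 0.063 ∣ 0.057, E3c 0.036 → 0.056; no new row, no new hypothesis kind. 7/8-WITNESS menu («THE 7/8 WITNESS», hubbard-downfold-unc-2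 g40, generator `gen-g40/yb/gen40.py …` over the g39/g38/g31 generators): the CAP menu of every cell now also holds the FOUR `n = 7/8` WITNESS-SPLIT cap planes of the pub/hubbard-fast reuse lane (reader spelling `∀ U s, 0 ≤ U → s ≤ 0 → e(1,s,U,7/8) ≤ T⁺ + D⁺·U + (−B⁺)·s`, cell form `holePlaneUS_tcap_on_cell`, `Observables/PhaseSeparationExclusionSplitPlaneSevenEighthsCap.lean`, this seat g40): the folded-Q1 `(5,7/8,−3/10)` state's plane BY NAME (`n7o8_splitPlaneQ1_of_split hQ1`, node `cert_plaqseam_W4splitQ1_TBD_allmk`, CERTIFIED #693–#695; lowest `7/8` cap for `U ≲ 6.0–6.3`), the #596 `(8,7/8,−3/10)` state's plane BY NAME (`n7o8_splitPlane_of_split hS596`, node `cert_plaqseam_W4split596_TBD_allmk`, CERTIFIED #610–#612), the STAGE-2 plane BY VALUE (`hW2m`, R12.52; lowest for `6.3 ≲ U ≲ 8.9–10.5`) and the V18 «WSP7» plane of the CERTIFIED dressed `(12,7/8,−3/10)` strip state BY VALUE (`hW7m`, R12.91 ×3, readers p782947; lowest above) — so the witness filling of a word may be `7/8` (weights `a =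 (1/8)/(1 − n₁)`, `b = 1 − a`: the dilute floor weighs `1/4` at `n₁ = 1/2` instead of `1/2` with the `3/4` planes), chosen per cell whenever it gives the better word (lower `β₀` ∕ larger margin ∕ stronger axis); every other ingredient as in the g39/g38 editions below. FAR-STRIP QUARTER-FLOOR edition («THE FAR-STRIP QUARTER FLOOR», hubbard-downfold-unc-2 g39, generator `gen-g39/yb/gen39.py far …` over the g38/g31 far-strip generators): the DILUTE FLOOR (`hF₁` slot) of every far cell is the best of (i) the ORACLE DESK's far-strip QUARTER floors — Jensen in `(t′, U)` for the jointly concave `(t′,U) ↦ e` between ONE certified registry row at `(U₁, 1/2, −3/10)` (#674 `U₁ = 10` ∣ #606 `U₁ = 8` ∣ #649 `U₁ = 6`, claim nodes `h674`/`h606`/`h649` BY NAME) and the kernel free row at `t′ = −11/20`, then Griffiths monotonicity in `U`: `c₀ + c₁·s ≤ e(1,s,U,1/2)` for `s ∈ [−11/20,−3/10]`, `U ≥ (4s+11/5)·U₁` (`n1o2_farJensen{674,606,649}_strip_of`, `Certificates/HubbardSquare_n1o2_farstrip_lower_jensen606_674_649.lean`, hubbard-fast-surr-4 g10, p775085; `−0.9421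 ∣ −0.9300` at `s = −2/5 ∣ −7/20` from #674 vs the FREE sea `−1.0206 ∣ −1.0532`: lifts `+0.078 ∣ +0.123`), used as is for `(≤ 1/2 ∣ ≥ 1)` and EXTRAPOLATED DOWN THE DENSITY by convexity of `n ↦ e` against the cell's best cap at `n₀ > 1/2` (`dilute_floor_of_halfFloor_of_cap`, g35) for `(≤ 9/20 ∣ ≥ 1)` / `(≤ 2/5 ∣ ≥ 1)`, and (ii) the free Fermi-sea `t′`-chord of the earlier editions — whichever gives the better word per cell (named in each docstring). RESULT: the FIRST `(≤ 1/2 ∣ ≥ 1)` words at `t′ < −3/10` (A1 `[−2/5,−7/20]`, A2 `[−7/20,−3/10]`, E3c `[−41/100,−2/5]`, E3 `[−9/20,−2/5]`). V16 edition («THE #660 PLANE», this seat g38): the CAP menu of every cell additionally holds the WITNESS-SPLIT PLANE of the CERTIFIED #660 strip state `(8, 3/4, −3/10)` at filling `3/4` (`T⁺ − B⁺·s + D⁺·U`, literals of record `−4440523991983/2⁴² ∣ 214787725653/2⁴⁴ ∣ 91533771269/2⁴²`, R12.73-signed; hypothesis `hV16` BY VALUE — the Lean claim node of the three COMPONENT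 rows is lit-4's to file; the hour it lands `hV16` is discharged BY NAME by a one-line `wsplit660_capPlane_of h660` with no other change): a `t′ = −3/10` state, nearly flat in `t′` (`0.0122·|s|`) where the WS597 plane of the `t′ = 0` state #597 rises by `0.3053·|s|` — V16 is the tighter cap above `U⋆(s) = 3.11 ∣ 4.96 ∣ 6.80 ∣ 9.57` at `s = −3/10 ∣ −1/4 ∣ −1/5 ∣ −1/8` and at every `U ≥ 1.3` for `s ≤ −7/20`. TILTED-CAP edition («THE TILTED CAPS», this seat g37): the CAP menu of every cell additionally holds the KERNEL TILTED (affine-in-`t′`) polarised-sea caps `tpc{D,S3,R3,R1}n0{700,750}` (one spin species at fillings `7/10 ∣ 3/4`; `Certificates/HubbardSquare_polarizedSeaCaps_tiltedStrip.lean` = `polarizedPlaneCheck` certificates with slope `B = B_S ≈ +0.37…+0.40` by `decide +kernel`, cell forms `Observables/PhaseSeparationExclusionStripTiltedPolCaps.lean`; [cite: BachLiebSolovej1994, eq. (2c.36)]) — sr-mbsolver's CONSTANT strip caps (g36 menu) bind at the LESS negative end of each strip and are `0.039 ∣ 0.020` loose at `t′ = −3/10 ∣ −1/4` (filling `3/4`):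 exact `T = 0` margins `D × [10,12] ∣ [12,14] ∣ [14,16] ∣ [12,16]` `(≤1/2∣≥1)` `0.0402 ∣ 0.0628 ∣ 0.0628 ∣ 0.0666 → 0.0587 ∣ 0.0814 ∣ 0.0814 ∣ 0.0851`, `(≤9/20∣≥1)` `0.0464 ∣ 0.0717 ∣ 0.0717 ∣ 0.0759 → 0.0668 ∣ 0.0925 ∣ 0.0925 ∣ 0.0967`; `R3 × [13,16]` `+0.0121 ∣ +0.0164`. SPLIT-CELL edition («VIRTUAL COLUMNS», this seat g37): a cell may end at an intermediate coupling `U⋆` whose `n = 1` column law is the `U`-CHORD of the two landed laws around it (`vcol_of_laws`, `Observables/PhaseSeparationExclusionVirtualColumns.lean`; concavity of `U ↦ e(1,s,U,1)`, Ruelle): `vQ45o4` = `es_n1_col10_d30 ⊕ ext5_n1_col12_d30` at `U⋆ = 45/4`, `v13` = `ext5_n1_col12_d30 ⊕ xu_n1_col16_d30` at `U⋆ = 13` (the `(12,16)` chord: the landed `U = 14` XU columns and R3's `xu_n1_law13_d20` lie below it) — so that the WS597 plane caps the lower part and a `U`-independent polarised cap the upper part of a cell in which the two cross: `Q × [10,12]`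 → `[10,45/4] ∪ [45/4,12]`: `(≤1/2∣≥1)` `0.0323 → 0.0415 ∣ 0.0410`, `(≤9/20∣≥1)` `0.0405 → 0.0485 ∣ 0.0496`; `R3 × [12,16]` → `[12,13] ∪ [13,16]`: `(≤1/2∣≥1)` `−0.0060 → 0.0124 ∣ 0.0121`, `(≤9/20∣≥1)` `−0.0025 → 0.0162 ∣ 0.0164`. LOW-U-QUARTER-FLOOR edition («THE LOW-U QUARTER FLOOR», generator flag `--lowU`): on cells with lower column `U₁ ∈ [4, 8)` the quarter-filling floor is the `t′`-chord between the `U`-chords #649 `(6,½,−3/10)` ⊕ #606 `(8,½,−3/10)` (free sea ⊕ #649 below `U = 6`) and #570 `(4,½,0) ≥ −1.1662314554` ⊕ #576 `(8,½,0)` — four registry rows BY NAME (`h649`/`h606`/`h570`/`h576`), no kinematic carry (`hw_half_floorLow68At` / `hw_half_floorLow46At`, `Observables/PhaseSeparationExclusionQuarterLowUFloor.lean`, this seat g36): `+0.026 ∣ +0.025 ∣ +0.024` over g34's free-chord floor at `U₀ = 6`, `s = −3/10 ∣ −1/4 ∣ −1/5` (`+0.019` at `13/2`, `+0.012` at `7`,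 `+0.006` at `15/2`); theorem names `cr…`/`ct…`. STRIP-POLARISED-CAP edition («THE 3/4-FILLING CAPS», generator flag `--pc`): the CAP menu of every cell additionally holds sr-mbsolver's PREMISE-FREE CONSTANT polarised-sea caps at fillings `7/10 ∣ 3/4 ∣ 17/20` on `t′ ∈ [−3/10,−1/5]` (`polS3n0700 = −0.7903676196`, `polS3n0750 = −0.7336528871`, `polS3n0850`; `polS4*`/`polS5*` on `[−1/5,−1/10]`/`[−1/10,0]`; `Observables/PhaseSeparationExclusionStripPolCaps.lean`, this seat g36, one-line instances of `Certificates/HubbardSquare_polarizedSeaCaps_cs3atlas{A,B}` [cite: BachLiebSolovej1994, eq. (2c.36)]) — at `U ≥ 12` they are the better word caps (witness filling `3/4` or `7/10` instead of `5/8`; the WS597 plane reads `−0.69∣−0.63` at `(12∣14, −3/10)`): exact `T = 0` margins `Q × [12,14]∣[14,16]∣[12,16]` `(≤1/2∣≥1)` `→ 0.0522∣0.0540∣0.0522`, `(≤9/20∣≥1)` `→ 0.0580∣0.0599∣0.0580`, `D × [12,16]` `→ 0.0666∣0.0759`; theorem names `cp…`/`cq…`. «THE #674 COLUMN» edition (hubbard-downfold-unc-2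 g36, generator `gen-g36/yb/gen36.py` over the g31–g35 generators): identical to the g35 FILLING-CONVEXITY-FLOOR edition except that the `U = 10` QUARTER-FILLING column is the `t′`-chord of the NEW certified row #674 `(10,½,−3/10) ≥ −0.9178863326` (`Certificates/HubbardSquare_U10_n1o2_tpm3o10_lower_row674.lean`, hubbard-algo-eng-8 twin-chain, tree 2026-08-30T04:04Z) and #607 `(10,½,0) ≥ −1.0777526533` — `hw_half_col10b` = `−1.0778 − 0.5329·s` (`+0.0092 ∣ +0.0077 ∣ +0.0061` over g35's #606-carried `hw_half_col10` at `s = −3/10 ∣ −1/4 ∣ −1/5`), its `U`-chord with `hw_half_col8` on `[8,10]` (`hw_half_floor810bAt`) (`Observables/PhaseSeparationExclusionQuarterConvexFloorB.lean`, this seat g36); for `(≤ 9/20 ∣ ≥ 1)` the DILUTE FLOOR at `n₁ = 9/20` is that column extrapolated down the density by convexity of `n ↦ e` against the WS597 filling-`3/4` plane or a kernel `5/8`-polarised cap at the same `(s, U₁)` (`dilute_floor_of_halfFloor_of_cap`, g35). Registry rows #674/#607 (and #606/#576 on `[8,10]`) enter as claim nodes BY NAME (`h674`/`h607`/`h606`/`h576`).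 Theorem names `cx…_9o20_…`.
PART 2 of the `PhaseSeparationExclusionFarPolCVK5GroundE1B` cell set (same premises / laws; split for the 400-line file limit).
HONEST FRAMING: see below.
Cells in this file: `wmK_1o4_E1_7o2to9o2` [7 / 2,9 / 2] ∣ `wmK_1o4_E1_9o2to5` [9 / 2,5] ∣ `wmK_1o4_E1_5to51o10` [5,51 / 10] ∣ `wmK_1o4_E1_51o10to21o4` [51 / 10,21 / 4] ∣ `wmK_1o4_E1_21o4to133o25` [21 / 4,133 / 25] ∣ `wmK_1o4_E1_133o25to11o2` [133 / 25,11 / 2] ∣ `wmK_1o4_E1_11o2to141o25` [11 / 2,141 / 25] ∣ `wmK_1o4_E1_141o25to6` [141 / 25,6] ∣ `wmK_1o4_E1_6to7` [6,7] ∣ `wmK_1o4_E1_7to8` [7,8] ∣ `wmK_1o4_E1_8to10` [8,10] ∣ `wmK_1o4_E1_10to12` [10,12] ∣ `wmK_1o4_E1_12to13` [12,13] ∣ `wmK_1o4_E1_13to16` [13,16].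
WHAT THIS IS NOT: see below.
-/

noncomputable section

namespace Summit.Ventures.CertifiedManyBodySolver.Observables

open Summit.Ventures.CertifiedManyBodySolver.Certificates Summit.Ventures.CertifiedManyBodySolver.Downfold
open Literature.MathematicalPhysics.QuantumLattice Literature.MathematicalPhysics.QuantumLattice.ThermodynamicLimit
open Literature.MathematicalPhysics.QuantumLattice.InfVolFermionState Set Filter

/-- **`(≤ 1/4 | ≥ 1)` GROUND STATES (`T = 0`): segment E1 `t′ ∈ [-11 / 20, -1 / 2] × U ∈ [13, 16]`** — for every `(s, U)` of the cell no mixture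
`λω₁ + (1−λ)ω₂` (`0 < λ < 1`) of translation-invariant states with densities `0 < ρ(ω₁) ≤ 1/4` and `1 ≤ ρ(ω₂) < 2` is a ground state, at ANY filling in between
(law `ps_not_groundState_mix_on_cell_of_columns_tcap`, hubbard-box-p3; cap = the PROVED kernel FULLY-POLARISED band cap `pol5o8_m55m50` (one spin species at density `5 / 8`, `U`-independent; no claim node) at filling `5 / 8`; `n = 1` columns `ds_n1_law_U13_m55m50` ∣ `ds_n1_law_U16_m55m50` BY NAME;
dilute floor = the `t′`-chord of the kernel free Fermi-sea rows at the segment ends (premise-free); exact column margins `U = 13`: M 0.4555∣0.4596; `U = 16`: M 0.4555∣0.4596). [cite: Israel1979, Thm. I.2.4] [cite: EmeryKivelsonLin1990, pp. 475–476] [cite: Ruelle1969, §3.3] -/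
theorem wmK_1o4_E1_13to16 (hsX10m64n1 : ∀ m : ℝ, 0 ≤ m → m < 2 → (((-170408017018056602937101811/30223145490365729367654400 : ℚ)) : ℝ) + (((5640075348923/1099511627776 : ℚ)) : ℝ) * m ≤ energyDensityTT' 1 (-16/25) 10 m) (hsX147o10m30n1 : ∀ m : ℝ, 0 ≤ m → m < 2 → (((-2157082003289552899133347/188894659314785808547840 : ℚ)) : ℝ) + (((3048405340245/274877906944 : ℚ)) : ℝ) * m ≤ energyDensityTT' 1 (-3/10) (147/10) m)
    {s : ℝ} (hs : s ∈ Icc (-11 / 20 : ℝ) (-1 / 2)) {U : ℝ} (hU : U ∈ Icc (13 : ℝ) (16))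
    {ω₁ ω₂ : InfVolFermionState 2} (h₁ : ω₁.IsTranslationInvariant) (h₂ : ω₂.IsTranslationInvariant)
    (hρ₁ : 0 < ω₁.density) (hρ₁' : ω₁.density ≤ 1 / 4) (hρ₂ : 1 ≤ ω₂.density) (hρ₂' : ω₂.density < 2)
    {lam : ℝ} (hl0 : 0 < lam) (hl1 : lam < 1) :
    energyDensityTT' 1 s U (mix lam hl0.le hl1.le ω₁ ω₂).density <
      (mix lam hl0.le hl1.le ω₁ ω₂).meanEnergy (hubbardTTPrimeFermionInteraction 1 s U) 1 := by
  refine ps_not_groundState_mix_on_cell_of_columns_tcap 1 (s₁ := -11 / 20) (s₂ := -1 / 2) (U₁ := 13) (U₂ := 16)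
    (n₁ := 1 / 4) (n₂ := 1) (a := 1 / 2) (b := 1 / 2) (c₀ := ((-7628957/10000000 : ℚ) : ℝ)) (cs := ((816499/2500000 : ℚ) : ℝ)) (c₁ := ((0 : ℚ) : ℝ))
    (by norm_num) (by norm_num) (by norm_num) (by norm_num) (by norm_num) (by norm_num) (by norm_num) (by norm_num)
    (pol5o8_m55m50_tcap_on_cell (by norm_num) (by norm_num) (by norm_num) (by norm_num))
    (fun s hs => ds_n1_law_U13_m55m50 hsX10m64n1 hsX147o10m30n1 s ⟨hs.1.trans' (by norm_num), hs.2.trans (by norm_num)⟩)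
    (fun s hs => ds_n1_law_U16_m55m50 hsX10m64n1 hsX147o10m30n1 s ⟨hs.1.trans' (by norm_num), hs.2.trans (by norm_num)⟩)
    (fun s hs U hU => floor_on_cell_of_tPrime_end_rows 1 (n := 1 / 4) (by norm_num) (by norm_num) (by norm_num)
      (fun _ hU' => fermiSeaTangentRow_tPrime_neg_eleven_div_twenty_at_one_div_four hU' (by norm_num) (by norm_num)) (fun _ hU' => fermiSeaTangentRow_tPrime_neg_one_div_two_at_one_div_four hU' (by norm_num) (by norm_num)) s ⟨hs.1.trans' (by norm_num), hs.2.trans (by norm_num)⟩ U (by linarith [hU.1]))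
    ?_ ?_ hs hU h₁ h₂ hρ₁ hρ₁' hρ₂ hρ₂' hl0 hl1
  · intro s hs; obtain ⟨h1, h2⟩ := hs; push_cast; norm_num; nlinarith [h1, h2]
  · intro s hs; obtain ⟨h1, h2⟩ := hs; push_cast; norm_num; nlinarith [h1, h2]

end Summit.Ventures.CertifiedManyBodySolver.Observables

end
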